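import Summits.ResolutionOfSingularities.ResolutionOfSingularities.Theorems.PurelyInseparableDim4ResConeBInfFrames
import Summits.ResolutionOfSingularities.ResolutionOfSingularities.Theorems.PurelyInseparableDim4ResConeNear
import Summits.ResolutionOfSingularities.ResolutionOfSingularities.Theorems.PurelyInseparableDim4PhiLineKeepRechoice
import Summits.ResolutionOfSingularities.ResolutionOfSingularities.Theorems.PurelyInseparableDim4PhiLineUFreePart
import Summits.ResolutionOfSingularities.ResolutionOfSingularities.Theorems.PurelyInseparableDim4PhiLineLabelVertex
import Summits.ResolutionOfSingularities.ResolutionOfSingularities.Theorems.PurelyInseparableDim4PhiLineDepartureLabel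
import Summits.ResolutionOfSingularities.ResolutionOfSingularities.Theorems.PurelyInseparableDim4PhiLineLabelTransport
import HarnessLib
import HarnessLib.Audit.Tags

/-!
# (5,3) B∞ assembly, STUB K: the KEEP step of the carried label — `RunInv` passes to the child with the same critical letter
# and `βs` STRICTLY smaller (cell `res-dim4-pi`, K2(p) lane, slice C (5,3) TAIL-B)

[OURS · counted 0 · cell `res-dim4-pi` · K2(p) lane (holder res-dim4-p-12 g4, «STUB K `stub_keep` is yours after R2» 2026-08-29 06:02Z;
skeleton `BInf-ASSEMBLY-SKELETON.lean` b10e0a76a4b9b1eb, stub stated here with `frameOf`/`resIdeal`/`EntryInv`/`RunInv` UNFOLDED, so the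
skeleton's `sorry` closes by `exact`) · seat res-dim4-p-7 g4.]  Nothing here proves K2(5), the β_h line or resolution of singularities in
dimension ≥ 4 / characteristic `p`.  AI kernel work, weaker than expert review.

At a P-state `c k` (`|r_k| = 3`, heavy letter `h` with `r_k h = 2`) of a B∞ tail with shade 3 and `e_G = 2`, carrying a run frame `L`
(left inverse `M`, `u₁ = e_h`, y-rows in `(resVertex)^⊥`, label polygon `pts ≠ ∅`, `3! < δs`, `0 < αs < 3!` for `(G_k)`), the child
`c (k+1)` carries a run frame `L′` with **`βs′ < βs`**.  Composition (each piece a tree theorem, cited by seat):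
1. res-dim4-p-1/p-12's `ResCone.bInf_pattern` (P-step: chart letter `m = j k ≠ h`, `b k h = 0`, `r_{k+1} h = 2`) and res-dim4-p-9 g4's
   `bInf_factorisation` / `bInf_step_factorisation` (`F_k = x^{r_k} G_k`, `ord G_k = 3`, the step factorisation IV wants);
2. `ResCone.direction_mem_resVertex_of_shade_eq` (the step direction lies in `resVertex`, so the y-rows kill it) and this seat's R2
   `PhiLine.exists_keep_rechoice` (re-choose `u₂ := x_m`, same `pts ≠ ∅, αs, βs, δs`);
3. res-dim4-p-11 g4's XIV `PhiLine.exists_label_of_yRows_annihilate` (departure label `G_k = Ψ(y) + Q`), VII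
   `chartTransform_translate_label`, II `step_F_eq_monomial_mul_residual` (child residual `G_{k+1} = ε·(Ψ(y′) + x_m Q′) + R`);
4. res-dim4-p-11 g4's IV **`PhiLine.betaS_step_lt_of_keep`** in the arrival frame (p-9's `arrival_left_inverse`): `pts′ ≠ ∅`, `αs′ = αs`,
   **`βs′ < βs`**;
5. res-dim4-p-11 g4's X `PhiLine.exists_label_readaptation_of_step` (re-adapt the y-rows along `u₁`: `3! < δs″`, `αs″ = αs′`, `βs″ = βs′`,
   `hT` by XI `two_le_finrank_additiveSubspace_of_resVertex`) and XIII `PhiLine.yRows_annihilate_of_label` (the new y-rows lie in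
   `(resVertex_{k+1})^⊥`).
[cite: CossartJannsenSaito2020, Lemma 12.1 (2), Lemma 13.6, Thm. 8.16] [cite: CossartPiltant2008, Lemma 4.5 (2), Prop. 4.2]
bears_on: LADDER-RESOLUTION:D157-DOOR2 (res-dim4-pi · K2(p) · slice C (5,3) TAIL-B · STUB K).  Supports stmt-ResolutionOfSingularities-16155
(helper).
-/

set_option linter.dupNamespace false

noncomputable section

namespace Summit.ResolutionOfSingularities.ResolutionOfSingularities.Theorems.PIDim4

namespace ResCone

open MvPolynomial Finset IsLocalRing
open Literature.AlgebraicGeometry.Resolution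
open Literature.AlgebraicGeometry.Resolution.CentreBlowup
open Literature.AlgebraicGeometry.Resolution.Hauser2010
open Literature.AlgebraicGeometry.Resolution.HauserPerlega2019
open Literature.AlgebraicGeometry.Resolution.WeightedOrder
open PointBlowup (additiveSubspace direction)

variable {K : Type} [Field K]

/-- A two-sided matrix inverse from a left inverse of a `Fin (2+2) × Fin 4` frame. [folklore] -/
theorem matrix_inverses_of_leftInverse {L : Fin (2 + 2) → Fin 4 → K} {M : Fin 4 → Fin (2 + 2) → K}
    (hM : ∀ t u, ∑ i, M t i * L i u = if t = u then 1 else 0) :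
    (Matrix.of fun (i : Fin 4) (t : Fin 4) => L i t) * (Matrix.of fun (t : Fin 4) (i : Fin 4) => M t i) = 1 ∧
      (Matrix.of fun (t : Fin 4) (i : Fin 4) => M t i) * (Matrix.of fun (i : Fin 4) (t : Fin 4) => L i t) = 1 := by
  have hBA : (Matrix.of fun (t : Fin 4) (i : Fin 4) => M t i) * (Matrix.of fun (i : Fin 4) (t : Fin 4) => L i t) = 1 := by
    ext t u
    rw [Matrix.mul_apply, Matrix.one_apply]
    exact hM t u
  exact ⟨mul_eq_one_comm.mp hBA, hBA⟩

variable [CharP K 5] [DecidableEq K]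

/-- **STUB K of the (5,3) B∞ assembly (KEEP step of the carried label)** — the skeleton's `stub_keep` with `frameOf`, `resIdeal`,
`EntryInv`, `RunInv` unfolded.  See the module docstring for the composition.
[cite: CossartJannsenSaito2020, Lemma 12.1 (2), Lemma 13.6] [cite: CossartPiltant2008, Lemma 4.5 (2)] -/
theorem stub_keep {c : ℕ → State K} {j : ℕ → Fin 4} {b : ℕ → Fin 4 → K}
    (hc : ∀ k, IsIsolated 5 (c k).F ∧ Step0 5 (c k) (c (k + 1))) (hw : FreeTail.IsWitnessedChain 5 c j b)
    (hr0 : ∀ e ∈ (c 0).F.support, (c 0).r ≤ e) (hfloor : ∀ k, ordZero (c k).F ≠ 5) {k₀ : ℕ}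
    (hshade : ∀ k, k₀ ≤ k → (c k).shade = ((3 : ℕ) : ℕ∞))
    (he : ∀ k, k₀ ≤ k → Module.finrank K (resVertex (c k)) = 2)
    {k : ℕ} (hk : k₀ ≤ k) (h3 : (c k).r.degree = 3) {h : Fin 4} {L : Fin (2 + 2) → Fin 4 → K}
    {M : Fin 4 → Fin (2 + 2) → K}
    (hinv : ((∀ t u, ∑ i, M t i * L i u = if t = u then 1 else 0) ∧ L (u1 2) = Pi.single h 1 ∧
        (∀ i, i ≠ u1 2 → i ≠ u2 2 → ∀ w ∈ resVertex (c k), ∑ t, L i t * w t = 0) ∧ (c k).r h = 2 ∧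
        (pts (fun i => algebraMap (MvPolynomial (Fin 4) K) (OriginLocalization K 4) (∑ t, C (L i t) * X t))
          (Ideal.span {algebraMap (MvPolynomial (Fin 4) K) (OriginLocalization K 4)
            ((c k).F.divMonomial (c k).r)}) 3).Nonempty ∧
        Nat.factorial 3 < deltaS (fun i => algebraMap (MvPolynomial (Fin 4) K) (OriginLocalization K 4)
          (∑ t, C (L i t) * X t)) (Ideal.span {algebraMap (MvPolynomial (Fin 4) K) (OriginLocalization K 4)
            ((c k).F.divMonomial (c k).r)}) 3 ∧
        alphaS (fun i => algebraMap (MvPolynomial (Fin 4) K) (OriginLocalization K 4) (∑ t, C (L i t) * X t))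
          (Ideal.span {algebraMap (MvPolynomial (Fin 4) K) (OriginLocalization K 4)
            ((c k).F.divMonomial (c k).r)}) 3 < Nat.factorial 3) ∧
      0 < alphaS (fun i => algebraMap (MvPolynomial (Fin 4) K) (OriginLocalization K 4) (∑ t, C (L i t) * X t))
          (Ideal.span {algebraMap (MvPolynomial (Fin 4) K) (OriginLocalization K 4)
            ((c k).F.divMonomial (c k).r)}) 3) :
    ∃ (L' : Fin (2 + 2) → Fin 4 → K) (M' : Fin 4 → Fin (2 + 2) → K),
      (((∀ t u, ∑ i, M' t i * L' i u = if t = u then 1 else 0) ∧ L' (u1 2) = Pi.single h 1 ∧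
          (∀ i, i ≠ u1 2 → i ≠ u2 2 → ∀ w ∈ resVertex (c (k + 1)), ∑ t, L' i t * w t = 0) ∧ (c (k + 1)).r h = 2 ∧
          (pts (fun i => algebraMap (MvPolynomial (Fin 4) K) (OriginLocalization K 4) (∑ t, C (L' i t) * X t))
            (Ideal.span {algebraMap (MvPolynomial (Fin 4) K) (OriginLocalization K 4)
              ((c (k + 1)).F.divMonomial (c (k + 1)).r)}) 3).Nonempty ∧
          Nat.factorial 3 < deltaS (fun i => algebraMap (MvPolynomial (Fin 4) K) (OriginLocalization K 4)
            (∑ t, C (L' i t) * X t)) (Ideal.span {algebraMap (MvPolynomial (Fin 4) K) (OriginLocalization K 4)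
              ((c (k + 1)).F.divMonomial (c (k + 1)).r)}) 3 ∧
          alphaS (fun i => algebraMap (MvPolynomial (Fin 4) K) (OriginLocalization K 4) (∑ t, C (L' i t) * X t))
            (Ideal.span {algebraMap (MvPolynomial (Fin 4) K) (OriginLocalization K 4)
              ((c (k + 1)).F.divMonomial (c (k + 1)).r)}) 3 < Nat.factorial 3) ∧
        0 < alphaS (fun i => algebraMap (MvPolynomial (Fin 4) K) (OriginLocalization K 4) (∑ t, C (L' i t) * X t))
            (Ideal.span {algebraMap (MvPolynomial (Fin 4) K) (OriginLocalization K 4)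
              ((c (k + 1)).F.divMonomial (c (k + 1)).r)}) 3) ∧
      betaS (fun i => algebraMap (MvPolynomial (Fin 4) K) (OriginLocalization K 4) (∑ t, C (L' i t) * X t))
          (Ideal.span {algebraMap (MvPolynomial (Fin 4) K) (OriginLocalization K 4)
            ((c (k + 1)).F.divMonomial (c (k + 1)).r)}) 3 <
        betaS (fun i => algebraMap (MvPolynomial (Fin 4) K) (OriginLocalization K 4) (∑ t, C (L i t) * X t))
          (Ideal.span {algebraMap (MvPolynomial (Fin 4) K) (OriginLocalization K 4)
            ((c k).F.divMonomial (c k).r)}) 3 := by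
  obtain ⟨⟨hM, hLu1, hy, hrh, hne, hδ, hα1⟩, hα0⟩ := hinv
  -- abbreviations
  set alg := algebraMap (MvPolynomial (Fin 4) K) (OriginLocalization K 4) with halg
  set G := (c k).F.divMonomial (c k).r with hGdef
  set G' := (c (k + 1)).F.divMonomial (c (k + 1)).r with hG'def
  -- 1. the B∞ tail facts at `k` and `k + 1`
  obtain ⟨hF, hd, hp, hsupp⟩ := bInf_factorisation hc hw hr0 hfloor hshade hk
  have hk1 : k₀ ≤ k + 1 := hk.trans (Nat.le_succ k)
  obtain ⟨hF₁, hd₁, -, -⟩ := bInf_factorisation hc hw hr0 hfloor hshade hk1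
  obtain ⟨hjh, hbh, hr₁h, -⟩ := (bInf_pattern hc hw hr0 hfloor hshade hk hrh).1 h3
  obtain ⟨hF', hd'⟩ := bInf_step_factorisation hc hw hr0 hfloor hshade hk
  have hbm : b k (j k) = 0 := (hw k).2.1
  have hck1 : c (k + 1) = CentreBlowup.step 5 Finset.univ (j k) (b k) (c k) := (hw k).2.2.2.2
  have hhm : h ≠ j k := fun h' => hjh h'.symm
  have hdG : ((3 : ℕ) : ℕ∞) ≤ ordZero G := hd.symm.le
  have hJμ : Ideal.span {alg G} ≤ maximalIdeal (OriginLocalization K 4) ^ 3 :=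
    PhiLine.span_singleton_algebraMap_le_maximalIdeal_pow hdG
  -- 2. the step direction lies in `resVertex (c k)`, so the y-rows kill it
  have ho : ordZero (c k).F = ((6 : ℕ) : ℕ∞) := by
    rw [hF, PhiLine.ordZero_monomial_one_mul, hd, h3]; rfl
  have hshade_eq : (CentreBlowup.step 5 Finset.univ (j k) (b k) (c k)).shade = (c k).shade := by
    rw [← hck1, hshade (k + 1) hk1, hshade k hk]
  have hdir : direction (j k) (b k) ∈ resVertex (c k) :=
    direction_mem_resVertex_of_shade_eq (q := 5) (j k) hbm ho hsupp (by norm_num) (by norm_num) hshade_eq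
  have hrows : ∀ i, i ≠ u1 2 → i ≠ u2 2 → ∑ t, L i t * Function.update (b k) (j k) 1 t = 0 :=
    fun i hi1 hi2 => hy i hi1 hi2 _ hdir
  -- R2: re-choose `u₂ := x_{j k}`
  obtain ⟨Lr, Mr, hMr, hLru1, hLru2, hLri, hnear, hner, hαr, hβr, hδr⟩ :=
    PhiLine.exists_keep_rechoice L M hM hLu1 (dir := Function.update (b k) (j k) 1) (Function.update_self _ _ _)
      (by rw [Function.update_of_ne hhm, hbh]) hrows hJμ hne hα0
  -- the y-rows of the re-chosen frame still lie in `(resVertex (c k))^⊥`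
  have hyr : ∀ i, i ≠ u1 2 → i ≠ u2 2 → ∀ w ∈ resVertex (c k), ∑ t, Lr i t * w t = 0 := by
    intro i hi1 hi2 w hw'
    rw [hLri i hi2]
    exact hy i hi1 hi2 w hw'
  obtain ⟨hArBr, hBrAr⟩ := matrix_inverses_of_leftInverse hMr
  -- 3. the departure label `G = Ψ(y) + Q` (res-dim4-p-11 g4's XIV)
  obtain ⟨Ψ, hΨ, hΨA, Q, hQ, hGΨ⟩ := PhiLine.exists_label_of_yRows_annihilate 5 (d := 3) (by norm_num) hF hd hArBr hBrAr
    (he k hk) (fun i hi1 hi2 w hw' => by simpa only [Matrix.of_apply] using hyr i hi1 hi2 w hw')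
  -- the weak transform read in the arrival y-rows (res-dim4-p-11 g4's VII)
  obtain ⟨Q', hH₀⟩ := PhiLine.chartTransform_translate_label (j := j k) hbm (fun i : Fin 2 => Lr (Fin.castAdd 2 i))
    (fun i => hnear _ (castAdd_ne_u2 i)) hΨ hQ (G := G) (by simpa only [Matrix.of_apply] using hGΨ) hdG
  -- the child residual `G' = ε · H₀ + R` (res-dim4-p-11 g4's II + p-9's step factorisation)
  obtain ⟨R, hstep, hRmem⟩ := PhiLine.step_F_eq_monomial_mul_residual (p := 5) (d := 3) hF hdG hp (j k) hbm
  rw [hF', monomial_one_mul_cancel_left_iff] at hstep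
  have hr'h : (((c k).r.filter fun i => b k i = 0).update (j k) ((c k).r.degree + 3 - 5)) h = 2 := by
    rw [Finsupp.coe_update, Function.update_of_ne hhm, Finsupp.filter_apply_pos (fun i => b k i = 0) (c k).r hbh, hrh]
  have hR : R ∈ Ideal.span {(X h : MvPolynomial (Fin 4) K) ^ 3} := by
    have := hRmem h (by rw [hr'h]; decide)
    rwa [hr'h] at this
  have hε := PhiLine.constantCoeff_prod_ne_zero (b k) (fun i => (c k).r i)
  -- 4. the arrival frame and the KEEP law (res-dim4-p-11 g4's IV, p-9's `arrival_left_inverse`)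
  set La : Fin (2 + 2) → Fin 4 → K :=
    Function.update (fun i => Function.update (Lr i) (j k) 0) (u2 2) (Pi.single (j k) 1) with hLa
  have hLau2 : La (u2 2) = Pi.single (j k) 1 := by rw [hLa, Function.update_self]
  have hLai : ∀ i, i ≠ u2 2 → La i = Function.update (Lr i) (j k) 0 := fun i hi => by
    rw [hLa, Function.update_of_ne hi]
  have hMa := arrival_left_inverse hMr (piv := u2 2) hLru2 hLau2 hLai
  obtain ⟨hnea, hαa, hβa⟩ := PhiLine.betaS_step_lt_of_keep (p := 5) (d := 3) hF hd (by norm_num) (by norm_num) hp hhm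
    (by rw [hrh]) hbm hbh Lr La Mr _ hMr hMa hLru1 hLru2 hnear hLau2 hLai hner (by rw [hδr]; exact hδ)
    (by rw [hαr]; exact hα1) hF' hd'
  -- 5. the arrival frame is again a label after re-adapting its y-rows along `u₁` (res-dim4-p-11 g4's X) …
  obtain ⟨hAB, hBA⟩ := matrix_inverses_of_leftInverse hMa
  have hT := PhiLine.two_le_finrank_additiveSubspace_of_resVertex hF₁ hd₁ (he (k + 1) hk1)
  have hrowsA : (fun i : Fin 2 => ∑ t, C ((Matrix.of fun (i : Fin 4) (t : Fin 4) => La i t) (Fin.castAdd 2 i) t) * X t) =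
      fun i : Fin 2 => ∑ t, C (Function.update (Lr (Fin.castAdd 2 i)) (j k) 0 t) * X t := by
    funext i
    simp only [Matrix.of_apply, hLai _ (castAdd_ne_u2 i)]
  have hH₀A : PointBlowup.translate (b k) (CentreBlowup.chartTransform 3 Finset.univ (j k) G) =
      aeval (fun i : Fin 2 => ∑ t, C ((Matrix.of fun (i : Fin 4) (t : Fin 4) => La i t) (Fin.castAdd 2 i) t) * X t) Ψ +
        X (j k) * Q' := by
    rw [hrowsA]; exact hH₀
  have hAu2 : (Matrix.of fun (i : Fin 4) (t : Fin 4) => La i t) (u2 2) = Pi.single (j k) 1 := by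
    funext t; rw [Matrix.of_apply, hLau2]
  have hLau1 : La (u1 2) = Pi.single h 1 := by
    rw [hLai _ u1_ne_u2, hLru1, PhiLine.update_single_of_ne hhm]
  have hAu1 : (Matrix.of fun (i : Fin 4) (t : Fin 4) => La i t) (u1 2) = Pi.single h 1 := by
    funext t; rw [Matrix.of_apply, hLau1]
  obtain ⟨lam, A', B', hA'B', hB'A', -, hA'u1, -, hne'', hδ'', hα'', hβ''⟩ :=
    PhiLine.exists_label_readaptation_of_step 5 (d := 3) (by norm_num) hAB hBA (u := u2 2)
      (Finset.mem_insert_of_mem (Finset.mem_singleton_self _)) hAu2 hAu1 (e := 3) (by norm_num) le_rfl hstep hd' hε hR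
      hH₀A hΨ hΨA hT hnea (by simp only [Matrix.of_apply]; rw [hαa, hαr]; exact hα0)
      (by simp only [Matrix.of_apply]; rw [hαa, hαr]; exact hα1)
  simp only [Matrix.of_apply] at hα'' hβ''
  -- … and its y-rows lie in `(resVertex (c (k+1)))^⊥` (res-dim4-p-11 g4's XIII)
  have hy'' := PhiLine.yRows_annihilate_of_label 5 (d := 3) (by norm_num) hF₁ hd₁ hA'B' hB'A' (he (k + 1) hk1) hδ''
  refine ⟨A', B', ⟨⟨fun t u => ?_, ?_, fun i hi1 hi2 w hw' => hy'' i hi1 hi2 w hw', hr₁h, hne'', hδ'', ?_⟩, ?_⟩, ?_⟩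
  · have h1 := congrFun (congrFun hB'A' t) u
    rw [Matrix.mul_apply, Matrix.one_apply] at h1
    exact h1
  · rw [hA'u1, hAu1]
  · rw [hα'', hαa, hαr]; exact hα1
  · rw [hα'', hαa, hαr]; exact hα0
  · rw [hβ'', ← hβr]; exact hβa

end ResCone

end Summit.ResolutionOfSingularities.ResolutionOfSingularities.Theorems.PIDim4

end
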